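import Summits.ResolutionOfSingularities.ResolutionOfSingularities.Theorems.PurelyInseparableDim4ChartAtlasSNCFarRepairAdmissible
import Summits.ResolutionOfSingularities.ResolutionOfSingularities.Theorems.PurelyInseparableDim4ChartAtlasSNCDisjointCentres
import Summits.ResolutionOfSingularities.ResolutionOfSingularities.Theorems.PurelyInseparableDim4CoordinateSNCTranslated
import Summits.ResolutionOfSingularities.ResolutionOfSingularities.Theorems.PurelyInseparableDim4MohAlong
import HarnessLib

/-!
# Purely inseparable four-folds `z^p + F(x₁, …, x₄)`: THE FAR-RESONANCE REPAIR AT A SECOND HEIGHT — R5 transported along the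
# `y_j`-translation of the chart model (cell `res-dim4-pi`, typ-2 g7; HANDOFF OPEN 2, memo S3-N2-SNC-CRITERION §11:20Z, file F2)

[OURS · counted 0] (D-0157 DOOR 2; DR-157-C.) Chart model of the escaping step in R1's frame (p706678: `y_j ↦ y_j − c′`, first resonant height
at `y_j = 0`, old exceptional hyperplane at `y_j = c′`): boundary `E` of hyperplanes `(y_m + a)·𝒪`, `(m, a) ∈ H₀`, and translated far
quadrics `TQ_k = ((y_k + b_k)·y_j − c′·y_k + e_k)·𝒪`, `k ∈ fs ∌ j`, `e_k + b_k c′ ≠ 0`; escaping centre `Zc = V(y_0, y_T)` (`j ∉ T`); a SECOND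
resonant height `δ` (`Σ″ = Zc ∩ {y_j = δ}`: members with `e_k + b_k δ = 0`, and a hyperplane `y_j − δ`); `C₂ = ψ^*𝓘(Σ′)` for the translation
`ψ = ψ_{−δ} : y_j ↦ y_j − δ` (F1 p715277). PROVED here (no `sorry`, no new axiom):

* `strictTransformIdeal_comp_base`, `controlledTransform_comp_base` — transforms along `τ ≫ f` are transforms along `τ` of the pulled-back data
  (any schemes);
* `spec_translate_single_comp`, `isBlowup_comp_spec_translate` — `ψ_t ≫ ψ_{−t} = 𝟙`; a blowing up along `ψ^*C` followed by `ψ` is a blowing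
  up along `C` (Literature `IsBlowup.comp_iso`);
* `translateEquiv_single_succ_hyp`, `comap_spec_translate_hypSheaf` — the hypersurface in the translated frame: `θ_t(z^p + F) = z^p + F(x_j + t)`,
  `ψ_t^*((z^p + F)·𝒪) = (z^p + F(x_j + t))·𝒪`;
* `forall_mem_map_comap_spec_translate` — the chart-model alphabet is closed under `y_j`-translations (F1's dictionary as a lemma: `c′ ↦ c′ − t`,
  `e_k ↦ e_k + b_k t`, hyperplane constants shifted on index `j⁺`); `comap_spec_translate_𝓘Λ_centre` — `ψ_t` fixes `Zc`;
* `X_add_C_mem_insert_of_hyperplane_mem`, `X_add_C_mem_of_tquadric_mem`, `mem_support_comap_spec_translate_𝓘Λ_iff` — a member AT HEIGHT `h`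
  (hyperplane `y_j − h`, or `TQ_k` with `k ∈ T`, `e_k = −b_k h`) meets `Zc` only inside `Zc ∩ {y_j = h} = V(ψ_{−h}^*𝓘(Σ′))`;
* **`admissible_strictTransform_after_farRepair_translated`** — R5 (p709208) AT THE SECOND HEIGHT: for EVERY blowing up `τ` of `𝔸⁵` along
  `C₂` the strict transform `St_τ(Zc)` is regular, inside `supp(((z^p + F)·𝒪, E, p).transform τ C₂)`, and snc with `E.map St_τ ++ [τ^*C₂]`, under
  R4's hypotheses read at height `δ` (no condition on the members resonant there) — R5 in the frame `y_j ↦ y_j − δ` (`c′ ↦ c′ − δ`,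
  `e_k ↦ e_k + b_k δ`, `F ↦ F(x_j + δ)`, `T`-permissible by p-1's `MohAlong.ordAlong_translate`) carried back along `IsBlowup.comp_iso`.

Consumed by `…ChartAtlasSNCTwoHeights` (the two-height repair = p716496 `admissible_strictTransform_of_disjoint_repairs` + R5 + this file).
Nothing here is a statement about resolution of singularities in dimension ≥ 4 / characteristic `p` (NOT proved anywhere in this programme).
bears_on: LADDER-RESOLUTION:D157-DOOR2 (res-dim4-pi). Supports stmt-ResolutionOfSingularities-16155 (helper).
-/


-- every declaration of this summit lives under `Summit.ResolutionOfSingularities.ResolutionOfSingularities`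
-- (summit = problem), which the duplicate-namespace linter flags; house convention (cf. the Target file).
set_option linter.dupNamespace false

noncomputable section

open MvPolynomial CategoryTheory AlgebraicGeometry TopologicalSpace
open AlgebraicGeometry.Scheme.IdealSheafData (ofIdealTop)

namespace Summit.ResolutionOfSingularities.ResolutionOfSingularities.Theorems.PIDim4

open Literature.AlgebraicGeometry.Resolution
open Literature.AlgebraicGeometry.Resolution.AffinePointBlowup (P A γ)

namespace ChartDictionary

/-! ## §1 Transforms along a composite with an automorphism of the base -/

section CompBase

universe u

variable {X' X Y : Scheme.{u}} (τ : X' ⟶ X) (f : X ⟶ Y)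

/-- Strict transforms along `τ ≫ f` are strict transforms along `τ` of the pulled-back data. -/
theorem strictTransformIdeal_comp_base (C K : Y.IdealSheafData) :
    strictTransformIdeal (τ ≫ f) C K = strictTransformIdeal τ (C.comap f) (K.comap f) := by
  simp only [strictTransformIdeal, Scheme.IdealSheafData.comap_comp]

/-- Controlled transforms along `τ ≫ f` are controlled transforms along `τ` of the pulled-back data. -/
theorem controlledTransform_comp_base (C I : Y.IdealSheafData) (μ : ℕ) :
    controlledTransform (τ ≫ f) C I μ = controlledTransform τ (C.comap f) (I.comap f) μ := by
  simp only [controlledTransform, Scheme.IdealSheafData.comap_comp]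

end CompBase

/-! ## §2 The `y_j`-translation of `𝔸⁵`: hypersurface, centre, boundary alphabet -/

section Translate

variable {K : Type} [Field K] {p : ℕ} {T : Finset (Fin 4)} {j : Fin 4} {b e : Fin 4 → K} {c' δ : K}

/-- `ψ_t ≫ ψ_{−t} = 𝟙` for the automorphisms `ψ_t = Spec θ_t`, `θ_t : y_j ↦ y_j + t`, of `𝔸⁵` (F1's `translateEquiv_single_comp_neg`). -/
theorem spec_translate_single_comp (t : K) :
    Spec.map (CommRingCat.ofHom ((AffinePointBlowup.translateEquiv (n := 4) (Pi.single j.succ t) : A 4 K ≃ₐ[K] A 4 K) :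
        A 4 K →+* A 4 K)) ≫
      Spec.map (CommRingCat.ofHom ((AffinePointBlowup.translateEquiv (n := 4) (Pi.single j.succ (-t)) : A 4 K ≃ₐ[K] A 4 K) :
        A 4 K →+* A 4 K)) = 𝟙 (P 4 K) := by
  rw [← Spec.map_comp, ← CommRingCat.ofHom_comp, translateEquiv_single_comp_neg, CommRingCat.ofHom_id]
  exact Spec.map_id _

/-- **A blowing up along `ψ^*C` followed by the translation `ψ = ψ_{−δ}` is a blowing up along `C`** (Literature `IsBlowup.comp_iso` with the
isomorphism `ψ_{−δ}`, inverse `ψ_δ`). -/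
theorem isBlowup_comp_spec_translate {C : (P 4 K).IdealSheafData} {X₂ : Scheme.{0}} {τ : X₂ ⟶ P 4 K}
    (hτ : IsBlowup τ (C.comap (Spec.map (CommRingCat.ofHom
      ((AffinePointBlowup.translateEquiv (n := 4) (Pi.single j.succ (-δ)) : A 4 K ≃ₐ[K] A 4 K) : A 4 K →+* A 4 K))))) :
    IsBlowup (τ ≫ Spec.map (CommRingCat.ofHom
      ((AffinePointBlowup.translateEquiv (n := 4) (Pi.single j.succ (-δ)) : A 4 K ≃ₐ[K] A 4 K) : A 4 K →+* A 4 K))) C := by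
  let eψ : P 4 K ≅ P 4 K :=
    { hom := Spec.map (CommRingCat.ofHom
        ((AffinePointBlowup.translateEquiv (n := 4) (Pi.single j.succ (-δ)) : A 4 K ≃ₐ[K] A 4 K) : A 4 K →+* A 4 K))
      inv := Spec.map (CommRingCat.ofHom
        ((AffinePointBlowup.translateEquiv (n := 4) (Pi.single j.succ δ) : A 4 K ≃ₐ[K] A 4 K) : A 4 K →+* A 4 K))
      hom_inv_id := by
        have h := spec_translate_single_comp (K := K) (j := j) (-δ)
        rwa [neg_neg] at h
      inv_hom_id := spec_translate_single_comp (K := K) (j := j) δ }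
  have h := hτ.comp_iso eψ
  rwa [← Scheme.IdealSheafData.comap_comp, eψ.inv_hom_id, Scheme.IdealSheafData.comap_id] at h

/-- **The hypersurface in the translated frame**: `θ_t(z^p + F) = z^p + F(x_j + t)` (`z = y_0` is not moved). -/
theorem translateEquiv_single_succ_hyp (F : MvPolynomial (Fin 4) K) (t : K) :
    AffinePointBlowup.translateEquiv (n := 4) (Pi.single j.succ t) (hyp p F) = hyp p (PointBlowup.translate (Pi.single j t) F) := by
  have hX0 : AffinePointBlowup.translateEquiv (n := 4) (Pi.single j.succ t) (X 0 : A 4 K) = X 0 := by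
    rw [AffinePointBlowup.translateEquiv_X, Pi.single_eq_of_ne (Fin.succ_ne_zero j).symm, C_0, add_zero]
  have hren : ∀ G : MvPolynomial (Fin 4) K, AffinePointBlowup.translateEquiv (n := 4) (Pi.single j.succ t) (rename Fin.succ G) =
      rename Fin.succ (PointBlowup.translate (Pi.single j t) G) := by
    intro G
    have key : ((AffinePointBlowup.translateEquiv (n := 4) (Pi.single j.succ t) : A 4 K ≃ₐ[K] A 4 K) : A 4 K →ₐ[K] A 4 K).comp
        (rename Fin.succ) =
        (rename Fin.succ).comp (aeval fun i => (X i + C (Pi.single (M := fun _ => K) j t i) : MvPolynomial (Fin 4) K)) := by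
      refine MvPolynomial.algHom_ext fun i => ?_
      rw [AlgHom.comp_apply, AlgHom.comp_apply, rename_X]
      change AffinePointBlowup.translateEquiv (n := 4) (Pi.single j.succ t) (X i.succ) =
        rename Fin.succ (aeval (fun i => (X i + C (Pi.single (M := fun _ => K) j t i) : MvPolynomial (Fin 4) K)) (X i))
      rw [AffinePointBlowup.translateEquiv_X, aeval_X, map_add, rename_X, rename_C]
      congr 2
      by_cases hij : i = j
      · subst hij; rw [Pi.single_eq_same, Pi.single_eq_same]
      · rw [Pi.single_eq_of_ne hij, Pi.single_eq_of_ne (fun h => hij (Fin.succ_injective _ h))]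
    exact DFunLike.congr_fun key G
  unfold hyp
  rw [map_add, map_pow, hX0, hren]

/-- **`ψ_t^*((z^p + F)·𝒪) = (z^p + F(x_j + t))·𝒪`.** -/
theorem comap_spec_translate_hypSheaf (F : MvPolynomial (Fin 4) K) (t : K) :
    (hypSheaf p F).comap (Spec.map (CommRingCat.ofHom
      ((AffinePointBlowup.translateEquiv (n := 4) (Pi.single j.succ t) : A 4 K ≃ₐ[K] A 4 K) : A 4 K →+* A 4 K))) =
      hypSheaf p (PointBlowup.translate (Pi.single j t) F) := by
  rw [hypSheaf, hypSheaf, comap_ofIdealTop_span_γ_symm, RingHom.coe_coe, translateEquiv_single_succ_hyp]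

/-- **The chart-model alphabet is closed under `y_j`-translations** (F1's dictionary): along `ψ_t`, `⊤ ↦ ⊤`, `(y_m + a)·𝒪 ↦ (y_m + ([m = j⁺]t + a))·𝒪`,
`TQ_k(b, c′, e) ↦ TQ_k(b, c′ − t, e + b t)`. -/
theorem forall_mem_map_comap_spec_translate (t : K) (H H' : Finset (Fin (4 + 1) × K))
    (hH' : ∀ ma ∈ H, (ma.1, Pi.single (M := fun _ => K) j.succ t ma.1 + ma.2) ∈ H') (fs : Finset (Fin 4)) (hjfs : j ∉ fs)
    {E : List (Scheme.IdealSheafData (P 4 K))}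
    (hE : ∀ D ∈ E, D = ⊤ ∨ (∃ ma ∈ H, D = ofIdealTop (Ideal.span {(γ 4 K).symm (X ma.1 + C ma.2)})) ∨
      ∃ k ∈ fs, D = ofIdealTop (Ideal.span {(γ 4 K).symm ((X k.succ + C (b k)) * X j.succ - C c' * X k.succ + C (e k))})) :
    ∀ D ∈ E.map (·.comap (Spec.map (CommRingCat.ofHom
        ((AffinePointBlowup.translateEquiv (n := 4) (Pi.single j.succ t) : A 4 K ≃ₐ[K] A 4 K) : A 4 K →+* A 4 K)))),
      D = ⊤ ∨ (∃ ma ∈ H', D = ofIdealTop (Ideal.span {(γ 4 K).symm (X ma.1 + C ma.2)})) ∨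
      ∃ k ∈ fs, D = ofIdealTop (Ideal.span {(γ 4 K).symm
        ((X k.succ + C (b k)) * X j.succ - C (c' - t) * X k.succ + C (e k + b k * t))}) := by
  intro D hD
  obtain ⟨D₀, hD₀, rfl⟩ := List.mem_map.mp hD
  rcases hE D₀ hD₀ with h | ⟨ma, hma, h⟩ | ⟨k, hk, h⟩
  · left
    rw [h]
    simp only [Scheme.IdealSheafData.comap_top]
  · right; left
    refine ⟨(ma.1, Pi.single (M := fun _ => K) j.succ t ma.1 + ma.2), hH' ma hma, ?_⟩
    simp only [h]
    rw [comap_ofIdealTop_span_γ_symm, RingHom.coe_coe, translateEquiv_single_hyperplane]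
  · right; right
    refine ⟨k, hk, ?_⟩
    have hkj : k ≠ j := fun h' => hjfs (h' ▸ hk)
    simp only [h]
    rw [comap_ofIdealTop_span_γ_symm, RingHom.coe_coe, translateEquiv_single_tquadric (b := b) (e := e) (c' := c') t hkj]

/-- The translation `ψ_t` fixes the escaping centre `V(y_0, y_T)` (`j ∉ T`). -/
theorem comap_spec_translate_𝓘Λ_centre (hjT : j ∉ T) (t : K) :
    (AffineCoordBlowup.𝓘Λ 4 K (insert 0 (Fin.succ '' (T : Set (Fin 4))))).comap (Spec.map (CommRingCat.ofHom
      ((AffinePointBlowup.translateEquiv (n := 4) (Pi.single j.succ t) : A 4 K ≃ₐ[K] A 4 K) : A 4 K →+* A 4 K))) =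
      AffineCoordBlowup.𝓘Λ 4 K (insert 0 (Fin.succ '' (T : Set (Fin 4)))) := by
  refine comap_translate_𝓘Λ _ _ fun i hi => Pi.single_eq_of_ne (fun h => ?_) _
  subst h
  exact hjT ((succ_mem_centreVars_iff T j).mp hi)

/-! ## §3 Members at a given height meet the escaping centre only at that height -/

/-- A hyperplane `y_j + a` through a point of `Zc = V(y_0, y_T)`: the point lies in `Zc ∩ {y_j = −a} = V(ψ_a^* 𝓘(Σ′))`, i.e.
`y_i + [i = j⁺]·a ∈ 𝔭` for every variable `y_i` of `Σ′`. -/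
theorem X_add_C_mem_insert_of_hyperplane_mem (hjT : j ∉ T) (x : P 4 K) (a : K) (hx : (X j.succ + C a : A 4 K) ∈ x.asIdeal)
    (hT : ∀ i ∈ (insert 0 (Fin.succ '' (T : Set (Fin 4))) : Set (Fin (4 + 1))), (X i : A 4 K) ∈ x.asIdeal) :
    ∀ i ∈ (insert 0 (Fin.succ '' ((insert j T : Finset (Fin 4)) : Set (Fin 4))) : Set (Fin (4 + 1))),
      (X i + C (Pi.single (M := fun _ => K) j.succ a i) : A 4 K) ∈ x.asIdeal := by
  intro i hi
  by_cases hij : i = j.succ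
  · subst hij
    rwa [Pi.single_eq_same]
  · rw [Pi.single_eq_of_ne hij, C_0, add_zero]
    refine hT i ?_
    rcases Set.mem_insert_iff.mp hi with rfl | ⟨t, ht, rfl⟩
    · exact Set.mem_insert _ _
    · rcases Finset.mem_insert.mp (Finset.mem_coe.mp ht) with rfl | ht
      · exact absurd rfl hij
      · exact Set.mem_insert_of_mem _ ⟨t, Finset.mem_coe.mpr ht, rfl⟩

/-- A far quadric `TQ_k`, `k ∈ T`, AT HEIGHT `h` (`e_k = −b_k·h`, `b_k ≠ 0`) through a point of `Zc`: the point has `y_j − h ∈ 𝔭`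
(modulo `y_k` the quadric is `b_k·(y_j − h)`). -/
theorem X_add_C_mem_of_tquadric_mem (x : P 4 K) {k : Fin 4} {h : K} (hbk : b k ≠ 0) (hek : e k + b k * h = 0)
    (hQ : ((X k.succ + C (b k)) * X j.succ - C c' * X k.succ + C (e k) : A 4 K) ∈ x.asIdeal)
    (hXk : (X k.succ : A 4 K) ∈ x.asIdeal) : (X j.succ + C (-h) : A 4 K) ∈ x.asIdeal := by
  have h1 := x.asIdeal.sub_mem (x.asIdeal.sub_mem hQ (x.asIdeal.mul_mem_right (X j.succ) hXk))
    (x.asIdeal.mul_mem_left (-(C c')) hXk)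
  have hek' : e k = b k * (-h) := by
    have := eq_neg_of_add_eq_zero_left hek
    rw [this]; ring
  have e1 : ((X k.succ + C (b k)) * X j.succ - C c' * X k.succ + C (e k) - X k.succ * X j.succ - -C c' * X k.succ : A 4 K) =
      C (b k) * (X j.succ + C (-h)) := by
    rw [hek', C_mul]; ring
  rw [e1] at h1
  rcases x.2.mem_or_mem h1 with h2 | h2
  · exact absurd ((C_mem_asIdeal_iff x (b k)).mp h2) hbk
  · exact h2

/-- **The support of `ψ_{−h}^*𝓘(Σ′)` is `Zc ∩ {y_j = h}`**: membership test. -/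
theorem mem_support_comap_spec_translate_𝓘Λ_iff (t : K) (Λ' : Set (Fin (4 + 1))) (x : P 4 K) :
    x ∈ ((AffineCoordBlowup.𝓘Λ 4 K Λ').comap (Spec.map (CommRingCat.ofHom
      ((AffinePointBlowup.translateEquiv (n := 4) (Pi.single j.succ t) : A 4 K ≃ₐ[K] A 4 K) : A 4 K →+* A 4 K)))).support ↔
      ∀ i ∈ Λ', (X i + C (Pi.single (M := fun _ => K) j.succ t i) : A 4 K) ∈ x.asIdeal := by
  rw [Scheme.IdealSheafData.support_comap]
  change (Spec.map _) x ∈ (AffineCoordBlowup.𝓘Λ 4 K Λ').support ↔ _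
  rw [AffineCoordBlowup.support_𝓘Λ, AffineCoordBlowup.mem_CΛ_iff']
  refine forall₂_congr fun i _ => ?_
  rw [Spec.map_apply, PrimeSpectrum.comap_asIdeal, Ideal.mem_comap, CommRingCat.hom_ofHom, RingHom.coe_coe,
    AffinePointBlowup.translateEquiv_X]

/-! ## §4 R5 at the second height -/

/-- **R5 (p709208) AT THE SECOND HEIGHT.** In R1's frame, let `C₂ = ψ^*𝓘(Σ′)` (`ψ = ψ_{−δ}`), the ideal of `Σ″ = V(y_0, y_T, y_j − δ)`. For every
blowing up `τ` of `𝔸⁵` along `C₂`: `C' = St_τ(V(y_0, y_T))` is regular, `V(C') ⊆ supp M'` for `M' = ((z^p + F)·𝒪, E, p).transform τ C₂`, and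
`HasSNCWith (E.map St_τ ++ [τ^*C₂]) C'` — under R4's hypotheses READ AT HEIGHT `δ`: provenance `hC1`, `e_k + b_k c′ ≠ 0`, no index-`j`
hyperplane `y_j + a` with `a ≠ −δ` at the height of an active member with `e_k + b_k δ ≠ 0`, and pairwise distinct heights among those members
(NO condition on the members resonant at height `δ`). Proof: `τ ≫ ψ` is a blowing up along `𝓘(Σ′)` (`isBlowup_comp_spec_translate`); R5 for it
with the boundary `E.map ψ_δ^*` (alphabet `c′ − δ`, `e + b δ`), the hypersurface `z^p + F(x_j + δ)` (`T`-permissible by p-1's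
`MohAlong.ordAlong_translate`); then `St_{τ ≫ ψ} = St_τ ∘ ψ^*`, `ψ^*ψ_δ^* = id`. -/
theorem admissible_strictTransform_after_farRepair_translated (hjT : j ∉ T) (hc'δ : c' - δ ≠ 0) (H₀ : Finset (Fin (4 + 1) × K))
    (fs : Finset (Fin 4)) (hjfs : j ∉ fs) (hd : ∀ k ∈ fs, e k + b k * c' ≠ 0) (hC1 : ∀ k ∈ fs, ∀ a : K, (k.succ, a) ∈ H₀ → a = b k)
    (hHj : ∀ a : K, (j.succ, a) ∈ H₀ → a + δ ≠ 0 → ∀ k ∈ fs, k ∈ T → e k + b k * δ ≠ 0 → b k ≠ 0 → e k ≠ a * b k)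
    (hNh : ∀ k ∈ fs, ∀ k' ∈ fs, k ∈ T → k' ∈ T → e k + b k * δ ≠ 0 → e k' + b k' * δ ≠ 0 → k ≠ k' → b k ≠ 0 → b k' ≠ 0 →
      e k * b k' ≠ e k' * b k)
    {k₀ : Fin 4} (hk₀ : k₀ ∈ T) {E : List (Scheme.IdealSheafData (P 4 K))}
    (hE : ∀ D ∈ E, D = ⊤ ∨ (∃ ma ∈ H₀, D = ofIdealTop (Ideal.span {(γ 4 K).symm (X ma.1 + C ma.2)})) ∨
      ∃ k ∈ fs, D = ofIdealTop (Ideal.span {(γ 4 K).symm ((X k.succ + C (b k)) * X j.succ - C c' * X k.succ + C (e k))}))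
    (F : MvPolynomial (Fin 4) K) (hperm : (p : ℕ∞) ≤ CentreBlowup.ordAlong T F) {X₂ : Scheme.{0}} {τ : X₂ ⟶ P 4 K}
    (hτ : IsBlowup τ ((AffineCoordBlowup.𝓘Λ 4 K (insert 0 (Fin.succ '' ((insert j T : Finset (Fin 4)) : Set (Fin 4))))).comap
      (Spec.map (CommRingCat.ofHom ((AffinePointBlowup.translateEquiv (n := 4) (Pi.single j.succ (-δ)) : A 4 K ≃ₐ[K] A 4 K) :
        A 4 K →+* A 4 K))))) :
    let C₂ := (AffineCoordBlowup.𝓘Λ 4 K (insert 0 (Fin.succ '' ((insert j T : Finset (Fin 4)) : Set (Fin 4))))).comap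
      (Spec.map (CommRingCat.ofHom ((AffinePointBlowup.translateEquiv (n := 4) (Pi.single j.succ (-δ)) : A 4 K ≃ₐ[K] A 4 K) :
        A 4 K →+* A 4 K)))
    let M' := (⟨hypSheaf p F, E, p⟩ : MarkedIdeal (P 4 K)).transform τ C₂
    let C' := strictTransformIdeal τ C₂ (AffineCoordBlowup.𝓘Λ 4 K (insert 0 (Fin.succ '' (T : Set (Fin 4)))))
    Scheme.IsRegular C'.subscheme ∧ (C'.support : Set X₂) ⊆ M'.support ∧
      HasSNCWith (E.map (strictTransformIdeal τ C₂) ++ [C₂.comap τ]) C' := by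
  intro C₂ M' C'
  classical
  set Λ : Set (Fin (4 + 1)) := insert 0 (Fin.succ '' ((insert j T : Finset (Fin 4)) : Set (Fin 4))) with hΛ
  set ψm := Spec.map (CommRingCat.ofHom ((AffinePointBlowup.translateEquiv (n := 4) (Pi.single j.succ (-δ)) : A 4 K ≃ₐ[K] A 4 K) :
    A 4 K →+* A 4 K)) with hψm
  set ψp := Spec.map (CommRingCat.ofHom ((AffinePointBlowup.translateEquiv (n := 4) (Pi.single j.succ δ) : A 4 K ≃ₐ[K] A 4 K) :
    A 4 K →+* A 4 K)) with hψp
  have hmp : ψm ≫ ψp = 𝟙 _ := by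
    have h := spec_translate_single_comp (K := K) (j := j) (-δ)
    rwa [neg_neg] at h
  have hcomp : ∀ D : Scheme.IdealSheafData (P 4 K), (D.comap ψp).comap ψm = D := fun D => by
    rw [← Scheme.IdealSheafData.comap_comp, hmp, Scheme.IdealSheafData.comap_id]
  have hπ₁ : IsBlowup (τ ≫ ψm) (AffineCoordBlowup.𝓘Λ 4 K Λ) := isBlowup_comp_spec_translate hτ
  -- R5 in the frame `y_j ↦ y_j − δ`
  have hE' := forall_mem_map_comap_spec_translate (b := b) (e := e) (c' := c') δ H₀
    (H₀.image fun ma => (ma.1, Pi.single (M := fun _ => K) j.succ δ ma.1 + ma.2))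
    (fun ma hma => Finset.mem_image.mpr ⟨ma, hma, rfl⟩) fs hjfs hE
  have hd' : ∀ k ∈ fs, (e k + b k * δ) + b k * (c' - δ) ≠ 0 := fun k hk => by
    rw [show e k + b k * δ + b k * (c' - δ) = e k + b k * c' by ring]
    exact hd k hk
  have hC1' : ∀ k ∈ fs, ∀ a : K, (k.succ, a) ∈ (H₀.image fun ma => (ma.1, Pi.single (M := fun _ => K) j.succ δ ma.1 + ma.2)) →
      a = b k := by
    intro k hk a ha
    obtain ⟨ma, hma, hka⟩ := Finset.mem_image.mp ha
    obtain ⟨h1, h2⟩ := Prod.mk.inj hka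
    have hkj : ma.1 ≠ j.succ := fun h' => hjfs ((Fin.succ_injective _ (h1.symm.trans h')).symm ▸ hk)
    rw [← h2, h1, Pi.single_eq_of_ne (h1 ▸ hkj), zero_add]
    exact hC1 k hk ma.2 (h1 ▸ hma)
  have hHj' : ∀ a : K, (j.succ, a) ∈ (H₀.image fun ma => (ma.1, Pi.single (M := fun _ => K) j.succ δ ma.1 + ma.2)) → a ≠ 0 →
      ∀ k ∈ fs, k ∈ T → e k + b k * δ ≠ 0 → b k ≠ 0 → e k + b k * δ ≠ a * b k := by
    intro a ha ha0 k hk hkT hek hbk heq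
    obtain ⟨ma, hma, hka⟩ := Finset.mem_image.mp ha
    obtain ⟨h1, h2⟩ := Prod.mk.inj hka
    rw [h1, Pi.single_eq_same] at h2
    have hma' : (j.succ, ma.2) ∈ H₀ := by
      have e1 : ma = (j.succ, ma.2) := Prod.ext h1 rfl
      exact e1 ▸ hma
    have hne : ma.2 + δ ≠ 0 := by rw [add_comm, h2]; exact ha0
    refine hHj ma.2 hma' hne k hk hkT hek hbk ?_
    rw [← h2] at heq
    linear_combination heq
  have hNh' : ∀ k ∈ fs, ∀ k' ∈ fs, k ∈ T → k' ∈ T → e k + b k * δ ≠ 0 → e k' + b k' * δ ≠ 0 → k ≠ k' → b k ≠ 0 → b k' ≠ 0 →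
      (e k + b k * δ) * b k' ≠ (e k' + b k' * δ) * b k := by
    intro k hk k' hk' hkT hk'T hek hek' hkk hbk hbk' heq
    exact hNh k hk k' hk' hkT hk'T hek hek' hkk hbk hbk' (by linear_combination heq)
  have hperm' : (p : ℕ∞) ≤ CentreBlowup.ordAlong T (PointBlowup.translate (Pi.single j δ) F) := by
    rw [MohAlong.ordAlong_translate (Pi.single j δ) (fun i hi => Pi.single_eq_of_ne (ne_of_mem_of_not_mem hi hjT) _) F]
    exact hperm
  obtain ⟨hreg, hsupp, hsnc⟩ := admissible_strictTransform_after_farRepair (b := b) (e := fun k => e k + b k * δ) (c' := c' - δ)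
    hjT hc'δ _ fs hjfs hd' hC1' hHj' hNh' hk₀ hE' (PointBlowup.translate (Pi.single j δ) F) hperm' hπ₁
  -- back to R1's frame
  have hSt : ∀ D : Scheme.IdealSheafData (P 4 K),
      strictTransformIdeal (τ ≫ ψm) (AffineCoordBlowup.𝓘Λ 4 K Λ) (D.comap ψp) = strictTransformIdeal τ C₂ D := fun D => by
    rw [strictTransformIdeal_comp_base, hcomp]
  have hC : strictTransformIdeal (τ ≫ ψm) (AffineCoordBlowup.𝓘Λ 4 K Λ)
      (AffineCoordBlowup.𝓘Λ 4 K (insert 0 (Fin.succ '' (T : Set (Fin 4))))) = C' := by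
    rw [strictTransformIdeal_comp_base, comap_spec_translate_𝓘Λ_centre hjT]
  refine ⟨hC ▸ hreg, fun x hx => ?_, ?_⟩
  · have hx' : x ∈ ((strictTransformIdeal (τ ≫ ψm) (AffineCoordBlowup.𝓘Λ 4 K Λ)
        (AffineCoordBlowup.𝓘Λ 4 K (insert 0 (Fin.succ '' (T : Set (Fin 4)))))).support : Set X₂) := by
      rw [hC]; exact hx
    have h : ((p : ℕ) : ℕ∞) ≤ idealOrder (controlledTransform (τ ≫ ψm) (AffineCoordBlowup.𝓘Λ 4 K Λ)
        (hypSheaf p (PointBlowup.translate (Pi.single j δ) F)) p) x := hsupp hx'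
    rw [controlledTransform_comp_base, ← comap_spec_translate_hypSheaf F δ, hcomp] at h
    exact h
  · have hL : (E.map (·.comap ψp)).map (strictTransformIdeal (τ ≫ ψm) (AffineCoordBlowup.𝓘Λ 4 K Λ)) =
        E.map (strictTransformIdeal τ C₂) := by
      rw [List.map_map]
      exact List.map_congr_left fun D _ => hSt D
    rw [MarkedIdeal.transform_boundary, hL, Scheme.IdealSheafData.comap_comp, hC] at hsnc
    exact hsnc

end Translate

end ChartDictionary

end Summit.ResolutionOfSingularities.ResolutionOfSingularities.Theorems.PIDim4

end
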